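import Literature.NumberTheory.Sieve.GrimmeltMerikoski2025Poisson
import Literature.NumberTheory.Sieve.GrimmeltMerikoski2025Restricted
import HarnessLib

/-!
# Grimmelt–Merikoski 2025, Theorem 1.4 in the Poisson range `K ≤ X^{1-η}`

L. Grimmelt, J. Merikoski, *On the greatest prime factor and uniform equidistribution of quadratic
polynomials*, arXiv:2505.00493 [GrimmeltMerikoski2025], Theorem 1.4 (Type I estimate), vendored
in the range its proof treats as the named fact
`Literature.NumberTheory.Sieve.grimmeltMerikoski2025_thm14_restricted`
(`GrimmeltMerikoski2025Restricted.lean`).  §5 of the paper (p. 13) begins: "We may assume that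
for some small `η > 0` we have `K > X^{1-η}`, since otherwise the claim is trivial by applying
Poisson summation on `ℓ`."  This file PROVES that first reduction step (and the second one, the
passage to the difference of two scales) as theorems about the tree's Type I form `GM2025.typeISum`:

* `GM2025.typeISum_le_sum_norm`: `typeISum ≤ B₁ ∑_{d ≤ D} ∑_{k ≤ 2K, d ∣ k} |disc_{a,h}(k)|`
  when `|ψ₁| ≤ B₁`;
* `grimmeltMerikoski2025_thm14_poissonRange` — **Theorem 1.4 for `K ≤ X^{1-η}`**: for every
  fixed `η > 0` the statement of `grimmeltMerikoski2025_thm14_restricted` with the hypothesis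
  `K ≤ D X^{1+δ}` replaced by `K ≤ X^{1-η}` (by `GM2025.norm_rootDiscrepancy_le_of_poisson`
  every modulus `k ≤ 2K` has discrepancy `≤ 2X^δ ϱ(k) (2X^{-η})^{J-1}`, and with `δ = 1`,
  `J = ⌈6/η⌉ + 2` the whole Type I form is `≤ 1 ≤` the right-hand side for `X ≥ X₀(η)`);
* `GM2025.scaled_rootSum_sub_mainTerm`, `GM2025.typeISum_le_diffForm_add` — **the second
  reduction of §5** ("Let `X₁ = X` and `X₂ = K^{1/(1-η)}` … it suffices to bound
  `∑_d |∑_k ψ₁(k/K)(∑_ℓ ψ₂(ℓ/X) − (X/X₂)∑_ℓ ψ₂(ℓ/X₂))|`"): the Type I form is at most that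
  difference form plus `⌊D⌋ · 2K · B (X/X₂) · 2B · 2K (2K/X₂)^{J-1}`, the main term
  `(ϱ(k)/k) X ∫ψ₂` being `(X/X₂)∑_ℓ ψ₂(ℓ/X₂)` up to `(X/X₂) disc(k; X₂)`, which is small by the
  Poisson bound at scale `X₂ ≥ (2K)^{1/(1-η)}`.

What is NOT here: the complementary range `X^{1-η} < K ≤ D X^{1+δ}`, which is the content of the
paper — Lemma 3.1 (parametrisation by Heegner points and `Γ₀(ad)`), [GMtechnical, Thm 2.1]
(= Theorem 2.1 of the paper: spectral theory of automorphic forms, `θ = 7/64`), Propositions 4.x —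
none of it in Mathlib or the tree; `grimmeltMerikoski2025_thm14_restricted` stays a named fact.
The other trivial sub-range, the diagonal `X^{1/2-δ} ≤ D ≤ X^{1/2}`, is
`grimmeltMerikoski2025_thm14_diagonal` (`GrimmeltMerikoski2025TypeITrivial.lean`).

## References

* [GrimmeltMerikoski2025] arXiv:2505.00493, Theorem 1.4; §5, first paragraph (p. 13).
-/

noncomputable section

namespace Literature.NumberTheory.Sieve

open Finset

namespace GM2025

/-- `∑_{d ≤ D} |∑_{k ≡ 0 (d)} ψ₁(k/K) disc(k)| ≤ B₁ ∑_{d ≤ D} ∑_{k ≤ 2K, d ∣ k} |disc(k)|` when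
`|ψ₁| ≤ B₁`. [folklore] -/
theorem typeISum_le_sum_norm {ψ₁ : ℝ → ℂ} {B₁ : ℝ} (hB : ∀ u, ‖ψ₁ u‖ ≤ B₁) (a h : ℕ)
    (ψ₂ : ℝ → ℂ) (X K D : ℝ) :
    typeISum a h ψ₁ ψ₂ X K D ≤
      ∑ d ∈ Icc 1 ⌊D⌋₊, ∑ k ∈ (Icc 1 ⌊2 * K⌋₊).filter (fun k : ℕ => d ∣ k),
        B₁ * ‖rootDiscrepancy a h k ψ₂ X‖ := by
  unfold typeISum
  refine sum_le_sum fun d _ => (norm_sum_le _ _).trans (sum_le_sum fun k _ => ?_)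
  rw [norm_mul]
  exact mul_le_mul_of_nonneg_right (hB _) (norm_nonneg _)

end GM2025

open GM2025

/-! ### Theorem 1.4 in the Poisson range -/

/-- **Grimmelt–Merikoski 2025, Theorem 1.4 in the range `K ≤ X^{1-η}`** (PROVED; the first
reduction of [GrimmeltMerikoski2025, §5]: "We may assume that for some small `η > 0` we have
`K > X^{1-η}`, since otherwise the claim is trivial by applying Poisson summation on `ℓ`").
For every fixed `η > 0` and every `ε > 0` there are `δ > 0`, `J`, `X₀` such that for `X ≥ X₀`,
`1 ≤ D ≤ K ≤ X²`, **`K ≤ X^{1-η}`**, `D ≤ X^{1/2}`, `h` square-free with `1 ≤ h ≤ X^{2+δ}`,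
`1 ≤ a ≤ X^δ`, `gcd(a,h) = 1` and admissible `ψ₁, ψ₂` on `[1,2]`, `[-1,1]` (derivatives `≤ X^δ`
up to order `J`),
`∑_{d ≤ D} |∑_{k ≡ 0 (d)} ψ₁(k/K)(∑_{aℓ²+h ≡ 0 (k)} ψ₂(ℓ/X) − ρ_{a,h}(k) X ∫ψ₂/k)|
 ≤ X^ε · D^{1/2} X^{1/2} (D^{1/2} + h^{1/4}) (1 + X/(D(D + h^{1/2})))^{7/64}`
— the statement of `grimmeltMerikoski2025_thm14_restricted` with its hypothesis `K ≤ D X^{1+δ}`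
replaced by `K ≤ X^{1-η}`.  Proof: `|ψ₁| ≤ X^δ` and, by `GM2025.norm_rootDiscrepancy_le_of_poisson`,
every modulus `1 ≤ k ≤ 2K` has `|disc_{a,h}(k)| ≤ 2X^δ ϱ(k) (k/X)^{J-1} ≤ 2X^δ · 2X · (2X^{-η})^{J-1}`;
there are `≤ D · 2K ≤ 2X²` pairs `(d, k)`, so with `δ = 1`, `J = ⌈6/η⌉ + 2` the left-hand side
is `≤ 2^{J+2} X^{5-η(J-1)} ≤ 2^{J+2}/X ≤ 1` for `X ≥ 2^{J+2}`, while the right-hand side is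
`≥ 1`.  (In this range the bound is in fact `≪_A X^{-A}`; the complementary range
`X^{1-η} < K ≤ D X^{1+δ}` is the content of the paper and is NOT proved in the tree.)
[cite: GrimmeltMerikoski2025, Theorem 1.4 and §5 (first paragraph)] -/
theorem grimmeltMerikoski2025_thm14_poissonRange (η : ℝ) (hη : 0 < η) :
    ∀ ε : ℝ, 0 < ε → ∃ δ : ℝ, 0 < δ ∧ ∃ J : ℕ, ∃ X₀ : ℝ, ∀ X : ℝ, X₀ ≤ X →
    ∀ D K : ℝ, 1 ≤ D → D ≤ K → K ≤ X ^ 2 → K ≤ X ^ (1 - η) → D ≤ X ^ (1 / 2 : ℝ) →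
    ∀ h : ℕ, 1 ≤ h → Squarefree h → (h : ℝ) ≤ X ^ (2 + δ) →
    ∀ a : ℕ, 1 ≤ a → (a : ℝ) ≤ X ^ δ → Nat.Coprime a h →
    ∀ ψ₁ ψ₂ : ℝ → ℂ, IsAdmissibleWeight ψ₁ 1 2 J (X ^ δ) →
      IsAdmissibleWeight ψ₂ (-1) 1 J (X ^ δ) →
      typeISum a h ψ₁ ψ₂ X K D ≤
        X ^ ε * (D ^ (1 / 2 : ℝ) * X ^ (1 / 2 : ℝ) * (D ^ (1 / 2 : ℝ) + (h : ℝ) ^ (1 / 4 : ℝ)) *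
          (1 + X / (D * (D + (h : ℝ) ^ (1 / 2 : ℝ)))) ^ (7 / 64 : ℝ)) := by
  intro ε hε
  set J : ℕ := ⌈6 / η⌉₊ + 2 with hJdef
  have hJ2 : 2 ≤ J := by omega
  set C₀ : ℝ := 2 ^ (J + 2) with hC₀
  refine ⟨1, one_pos, J, max 2 C₀, ?_⟩
  intro X hX D K hD1 hDK _ hKX _ h _ _ _ a _ _ _ ψ₁ ψ₂ hψ₁ hψ₂
  have hX2 : (2 : ℝ) ≤ X := (le_max_left _ _).trans hX
  have hXC : C₀ ≤ X := (le_max_right _ _).trans hX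
  have hX1 : (1 : ℝ) ≤ X := by linarith
  have hX0 : (0 : ℝ) < X := by linarith
  have hK1 : (1 : ℝ) ≤ K := hD1.trans hDK
  have hKX1 : K ≤ X := hKX.trans (Real.rpow_le_self_of_one_le hX1 (by linarith))
  -- Step 1: `|ψ₁| ≤ X` and `ψ₂` is admissible with bound `X`
  have hB1 : ∀ u, ‖ψ₁ u‖ ≤ X := fun u => by simpa only [Real.rpow_one] using hψ₁.norm_le u
  have hψ₂' : IsAdmissibleWeight ψ₂ (-1) 1 J X := by simpa only [Real.rpow_one] using hψ₂
  -- Step 2: each discrepancy is tiny: `≤ 2X · 2X · (2X^{-η})^{J-1}`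
  set T : ℝ := 2 * X * (2 * X) * (2 * X ^ (-η)) ^ (J - 1) with hT
  have hdisc : ∀ k ∈ Icc 1 ⌊2 * K⌋₊, ‖rootDiscrepancy a h k ψ₂ X‖ ≤ T := by
    intro k hk
    have hk1 : 1 ≤ k := (mem_Icc.mp hk).1
    have hk2 : (k : ℝ) ≤ 2 * K :=
      (Nat.cast_le.mpr (mem_Icc.mp hk).2).trans (Nat.floor_le (by positivity))
    have hkX : (k : ℝ) / X ≤ 2 * X ^ (-η) := by
      rw [div_le_iff₀ hX0]
      calc (k : ℝ) ≤ 2 * K := hk2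
        _ ≤ 2 * X ^ (1 - η) := by linarith
        _ = 2 * X ^ (-η) * X := by
            rw [mul_assoc, ← Real.rpow_add_one hX0.ne' (-η)]; ring_nf
    have hρ : (rho a h k : ℝ) ≤ 2 * X := by
      calc (rho a h k : ℝ) ≤ k := by exact_mod_cast rho_le a h k
        _ ≤ 2 * K := hk2
        _ ≤ 2 * X := by linarith
    calc ‖rootDiscrepancy a h k ψ₂ X‖ ≤ 2 * X * rho a h k * ((k : ℝ) / X) ^ (J - 1) :=
          norm_rootDiscrepancy_le_of_poisson hψ₂' hJ2 a h hk1 hX0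
      _ ≤ 2 * X * (2 * X) * (2 * X ^ (-η)) ^ (J - 1) := by gcongr
  -- Step 3: at most `D · 2K ≤ 2X²` pairs `(d, k)`
  have hinner : ∀ d ∈ Icc 1 ⌊D⌋₊,
      ∑ k ∈ (Icc 1 ⌊2 * K⌋₊).filter (fun k : ℕ => d ∣ k), X * ‖rootDiscrepancy a h k ψ₂ X‖ ≤
        (2 * K) * (X * T) := by
    intro d _
    calc ∑ k ∈ (Icc 1 ⌊2 * K⌋₊).filter (fun k : ℕ => d ∣ k), X * ‖rootDiscrepancy a h k ψ₂ X‖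
        ≤ ∑ k ∈ (Icc 1 ⌊2 * K⌋₊).filter (fun k : ℕ => d ∣ k), X * T :=
          sum_le_sum fun k hk => mul_le_mul_of_nonneg_left (hdisc k (mem_filter.mp hk).1) hX0.le
      _ = #((Icc 1 ⌊2 * K⌋₊).filter (fun k : ℕ => d ∣ k)) * (X * T) := by
          rw [sum_const, nsmul_eq_mul]
      _ ≤ (2 * K) * (X * T) := by
          gcongr
          calc (#((Icc 1 ⌊2 * K⌋₊).filter (fun k : ℕ => d ∣ k)) : ℝ) ≤ #(Icc 1 ⌊2 * K⌋₊) := by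
                exact_mod_cast card_filter_le _ _
            _ = ⌊2 * K⌋₊ := by rw [Nat.card_Icc, Nat.add_sub_cancel]
            _ ≤ 2 * K := Nat.floor_le (by positivity)
  have htot : typeISum a h ψ₁ ψ₂ X K D ≤ D * ((2 * K) * (X * T)) := by
    calc typeISum a h ψ₁ ψ₂ X K D ≤ _ := typeISum_le_sum_norm hB1 a h ψ₂ X K D
      _ ≤ ∑ d ∈ Icc 1 ⌊D⌋₊, (2 * K) * (X * T) := sum_le_sum hinner
      _ = #(Icc 1 ⌊D⌋₊) * ((2 * K) * (X * T)) := by rw [sum_const, nsmul_eq_mul]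
      _ ≤ D * ((2 * K) * (X * T)) := by
          gcongr
          calc (#(Icc 1 ⌊D⌋₊) : ℝ) = ⌊D⌋₊ := by rw [Nat.card_Icc, Nat.add_sub_cancel]
            _ ≤ D := Nat.floor_le (by linarith)
  -- Step 4: the total is `≤ 2^{J+2} X^{5 - η(J-1)} ≤ 2^{J+2}/X ≤ 1`
  have hpow : (2 * X ^ (-η)) ^ (J - 1) = 2 ^ (J - 1) * X ^ (-(η * (J - 1 : ℕ))) := by
    rw [mul_pow, ← Real.rpow_natCast (X ^ (-η)) (J - 1), ← Real.rpow_mul hX0.le]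
    congr 2
    ring
  have hηJ : (6 : ℝ) ≤ η * (J - 1 : ℕ) := by
    have h1 : (J - 1 : ℕ) = ⌈6 / η⌉₊ + 1 := by omega
    rw [h1]
    push_cast
    have h2 : 6 / η ≤ ⌈6 / η⌉₊ := Nat.le_ceil _
    rw [div_le_iff₀ hη] at h2
    nlinarith
  have hXpow : X ^ (-(η * (J - 1 : ℕ))) ≤ X ^ (-6 : ℝ) :=
    Real.rpow_le_rpow_of_exponent_le hX1 (by linarith)
  have h2J : (2 : ℝ) ^ (J - 1) * 2 ^ 3 = 2 ^ (J + 2) := by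
    rw [← pow_add]; congr 1
  have hDX1 : D ≤ X := hDK.trans hKX1
  have hfinal : typeISum a h ψ₁ ψ₂ X K D ≤ 1 := by
    calc typeISum a h ψ₁ ψ₂ X K D ≤ D * ((2 * K) * (X * T)) := htot
      _ ≤ X * ((2 * X) * (X * T)) := by gcongr
      _ = 2 ^ (J - 1) * 2 ^ 3 * X ^ (5 : ℕ) * X ^ (-(η * (J - 1 : ℕ))) := by
          rw [hT, hpow]; ring
      _ ≤ 2 ^ (J - 1) * 2 ^ 3 * X ^ (5 : ℕ) * X ^ (-6 : ℝ) := by gcongr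
      _ = C₀ / X := by
          rw [h2J, hC₀, ← Real.rpow_natCast X 5, mul_assoc, ← Real.rpow_add hX0]
          norm_num
          rw [Real.rpow_neg_one, div_eq_mul_inv]
      _ ≤ 1 := by rwa [div_le_one hX0]
  -- Step 5: the right-hand side is `≥ 1`
  have hRHS : (1 : ℝ) ≤
      X ^ ε * (D ^ (1 / 2 : ℝ) * X ^ (1 / 2 : ℝ) * (D ^ (1 / 2 : ℝ) + (h : ℝ) ^ (1 / 4 : ℝ)) *
        (1 + X / (D * (D + (h : ℝ) ^ (1 / 2 : ℝ)))) ^ (7 / 64 : ℝ)) := by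
    have hD0 : (0 : ℝ) < D := by linarith
    have h1 : (1 : ℝ) ≤ X ^ ε := Real.one_le_rpow hX1 hε.le
    have h2 : (1 : ℝ) ≤ D ^ (1 / 2 : ℝ) := Real.one_le_rpow hD1 (by norm_num)
    have h3 : (1 : ℝ) ≤ X ^ (1 / 2 : ℝ) := Real.one_le_rpow hX1 (by norm_num)
    have h4 : (1 : ℝ) ≤ D ^ (1 / 2 : ℝ) + (h : ℝ) ^ (1 / 4 : ℝ) :=
      le_add_of_le_of_nonneg h2 (by positivity)
    have h5 : (1 : ℝ) ≤ (1 + X / (D * (D + (h : ℝ) ^ (1 / 2 : ℝ)))) ^ (7 / 64 : ℝ) :=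
      Real.one_le_rpow (le_add_of_nonneg_right (by positivity)) (by norm_num)
    calc (1 : ℝ) = 1 * (1 * 1 * 1 * 1) := by ring
      _ ≤ _ := by gcongr
  exact hfinal.trans hRHS

/-! ### The second reduction of §5: replacing the main term by the root sum at scale `X₂` -/

namespace GM2025

/-- `(X/X₂) · rootSum(k; ψ, X₂) − (ϱ(k)/k) X ∫ψ = (X/X₂) · disc(k; ψ, X₂)`. [folklore] -/
theorem scaled_rootSum_sub_mainTerm (a h k : ℕ) (ψ : ℝ → ℂ) (X : ℝ) {X₂ : ℝ} (hX₂ : X₂ ≠ 0) :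
    ((X / X₂ : ℝ) : ℂ) * rootSum a h k ψ X₂ - ((rho a h k : ℂ) / (k : ℂ)) * (X : ℂ) * ∫ u, ψ u =
      ((X / X₂ : ℝ) : ℂ) * rootDiscrepancy a h k ψ X₂ := by
  unfold rootDiscrepancy
  have hX₂C : (X₂ : ℂ) ≠ 0 := by exact_mod_cast hX₂
  push_cast
  field_simp

/-- **[GrimmeltMerikoski2025, §5, second paragraph]: "Let `X₁ = X` and `X₂ = K^{1/(1-η)} > X₁`.
Noting that the claim follows for `X = X₂` trivially by the Poisson summation formula, it suffices
to bound `∑_{d ≤ D} |∑_{k ≡ 0 (d)} ψ₁(k/K)(∑_{aℓ²+h ≡ 0 (k)} ψ₂(ℓ/X) − (X/X₂)∑ ψ₂(ℓ/X₂))|`."**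
Quantitatively (PROVED): for admissible `ψ₁` on `[1, 2]`, `ψ₂` on `[-1, 1]` with bound `B` and
`J ≥ 2` derivatives, `X, X₂, K > 0` and any `D`,
`typeISum ≤ (difference form at scales X, X₂) + D · 2K · B (X/X₂) · 2B · 2K · (2K/X₂)^{J-1}`:
writing `disc(k; X) = [rootSum(k; X) − (X/X₂) rootSum(k; X₂)] + (X/X₂) disc(k; X₂)`
(`scaled_rootSum_sub_mainTerm`), the second part is bounded by
`GM2025.norm_rootDiscrepancy_le_of_poisson` at scale `X₂` (`ϱ(k) ≤ k ≤ 2K`), and for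
`X₂ ≥ (2K)^{1/(1-η)}` it is `≤ D (2K)² 4B² (X/X₂) X₂^{-η(J-1)}`, negligible once `J ≥ J(η)`.
[cite: GrimmeltMerikoski2025, §5 (second paragraph)] -/
theorem typeISum_le_diffForm_add {ψ₁ ψ₂ : ℝ → ℂ} {J : ℕ} {B : ℝ}
    (hψ₁ : IsAdmissibleWeight ψ₁ 1 2 J B) (hψ₂ : IsAdmissibleWeight ψ₂ (-1) 1 J B) (hJ : 2 ≤ J)
    (a h : ℕ) {X X₂ K : ℝ} (hX : 0 < X) (hX₂ : 0 < X₂) (hK : 0 < K) (D : ℝ) :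
    typeISum a h ψ₁ ψ₂ X K D ≤
      (∑ d ∈ Icc 1 ⌊D⌋₊, ‖∑ k ∈ (Icc 1 ⌊2 * K⌋₊).filter (fun k : ℕ => d ∣ k),
        ψ₁ ((k : ℝ) / K) * (rootSum a h k ψ₂ X - ((X / X₂ : ℝ) : ℂ) * rootSum a h k ψ₂ X₂)‖) +
      ⌊D⌋₊ * (2 * K) * (B * ((X / X₂) * (2 * B * (2 * K) * ((2 * K) / X₂) ^ (J - 1)))) := by
  have hB0 : 0 ≤ B := hψ₂.bound_nonneg
  set c : ℝ := X / X₂ with hc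
  have hc0 : 0 ≤ c := div_nonneg hX.le hX₂.le
  set S := fun d : ℕ => (Icc 1 ⌊2 * K⌋₊).filter (fun k : ℕ => d ∣ k) with hS
  -- the pointwise decomposition of the discrepancy
  have hdec : ∀ k : ℕ, ψ₁ ((k : ℝ) / K) * rootDiscrepancy a h k ψ₂ X =
      ψ₁ ((k : ℝ) / K) * (rootSum a h k ψ₂ X - (c : ℂ) * rootSum a h k ψ₂ X₂) +
        ψ₁ ((k : ℝ) / K) * ((c : ℂ) * rootDiscrepancy a h k ψ₂ X₂) := by
    intro k
    rw [← scaled_rootSum_sub_mainTerm a h k ψ₂ X hX₂.ne', rootDiscrepancy]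
    ring
  -- the Poisson bound for the second part, per modulus
  have herr : ∀ k ∈ Icc 1 ⌊2 * K⌋₊,
      ‖ψ₁ ((k : ℝ) / K) * ((c : ℂ) * rootDiscrepancy a h k ψ₂ X₂)‖ ≤
        B * (c * (2 * B * (2 * K) * ((2 * K) / X₂) ^ (J - 1))) := by
    intro k hk
    have hk1 : 1 ≤ k := (mem_Icc.mp hk).1
    have hk2 : (k : ℝ) ≤ 2 * K :=
      (Nat.cast_le.mpr (mem_Icc.mp hk).2).trans (Nat.floor_le (by positivity))
    have hρ : (rho a h k : ℝ) ≤ 2 * K := (Nat.cast_le.mpr (rho_le a h k)).trans hk2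
    have hd := norm_rootDiscrepancy_le_of_poisson hψ₂ hJ a h hk1 hX₂
    rw [norm_mul, norm_mul, Complex.norm_real, Real.norm_of_nonneg hc0]
    refine mul_le_mul (hψ₁.norm_le _) (mul_le_mul_of_nonneg_left (hd.trans ?_) hc0)
      (by positivity) hB0
    gcongr
  calc typeISum a h ψ₁ ψ₂ X K D
      = ∑ d ∈ Icc 1 ⌊D⌋₊, ‖∑ k ∈ S d, (ψ₁ ((k : ℝ) / K) *
            (rootSum a h k ψ₂ X - (c : ℂ) * rootSum a h k ψ₂ X₂) +
          ψ₁ ((k : ℝ) / K) * ((c : ℂ) * rootDiscrepancy a h k ψ₂ X₂))‖ := by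
        unfold typeISum
        refine sum_congr rfl fun d _ => ?_
        rw [sum_congr rfl fun k _ => hdec k]
    _ ≤ ∑ d ∈ Icc 1 ⌊D⌋₊, (‖∑ k ∈ S d, ψ₁ ((k : ℝ) / K) *
            (rootSum a h k ψ₂ X - (c : ℂ) * rootSum a h k ψ₂ X₂)‖ +
          ∑ k ∈ S d, ‖ψ₁ ((k : ℝ) / K) * ((c : ℂ) * rootDiscrepancy a h k ψ₂ X₂)‖) := by
        refine sum_le_sum fun d _ => ?_
        rw [sum_add_distrib]
        exact (norm_add_le _ _).trans (add_le_add le_rfl (norm_sum_le _ _))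
    _ = (∑ d ∈ Icc 1 ⌊D⌋₊, ‖∑ k ∈ S d, ψ₁ ((k : ℝ) / K) *
            (rootSum a h k ψ₂ X - (c : ℂ) * rootSum a h k ψ₂ X₂)‖) +
          ∑ d ∈ Icc 1 ⌊D⌋₊, ∑ k ∈ S d,
            ‖ψ₁ ((k : ℝ) / K) * ((c : ℂ) * rootDiscrepancy a h k ψ₂ X₂)‖ := sum_add_distrib
    _ ≤ (∑ d ∈ Icc 1 ⌊D⌋₊, ‖∑ k ∈ S d, ψ₁ ((k : ℝ) / K) *
            (rootSum a h k ψ₂ X - (c : ℂ) * rootSum a h k ψ₂ X₂)‖) +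
          ∑ d ∈ Icc 1 ⌊D⌋₊, ∑ k ∈ S d, B * (c * (2 * B * (2 * K) * ((2 * K) / X₂) ^ (J - 1))) := by
        gcongr with d hd k hk
        exact herr k (mem_filter.mp hk).1
    _ ≤ (∑ d ∈ Icc 1 ⌊D⌋₊, ‖∑ k ∈ S d, ψ₁ ((k : ℝ) / K) *
            (rootSum a h k ψ₂ X - (c : ℂ) * rootSum a h k ψ₂ X₂)‖) +
          ⌊D⌋₊ * (2 * K) * (B * (c * (2 * B * (2 * K) * ((2 * K) / X₂) ^ (J - 1)))) := by
        gcongr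
        have hT0 : 0 ≤ B * (c * (2 * B * (2 * K) * ((2 * K) / X₂) ^ (J - 1))) := by positivity
        calc ∑ d ∈ Icc 1 ⌊D⌋₊, ∑ k ∈ S d, B * (c * (2 * B * (2 * K) * ((2 * K) / X₂) ^ (J - 1)))
            = ∑ d ∈ Icc 1 ⌊D⌋₊, #(S d) * (B * (c * (2 * B * (2 * K) * ((2 * K) / X₂) ^ (J - 1)))) := by
              simp only [sum_const, nsmul_eq_mul]
          _ ≤ ∑ d ∈ Icc 1 ⌊D⌋₊, (2 * K) * (B * (c * (2 * B * (2 * K) * ((2 * K) / X₂) ^ (J - 1)))) := by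
              refine sum_le_sum fun d _ => mul_le_mul_of_nonneg_right ?_ hT0
              calc (#(S d) : ℝ) ≤ #(Icc 1 ⌊2 * K⌋₊) := by exact_mod_cast card_filter_le _ _
                _ = ⌊2 * K⌋₊ := by rw [Nat.card_Icc, Nat.add_sub_cancel]
                _ ≤ 2 * K := Nat.floor_le (by positivity)
          _ = ⌊D⌋₊ * (2 * K) * (B * (c * (2 * B * (2 * K) * ((2 * K) / X₂) ^ (J - 1)))) := by
              rw [sum_const, nsmul_eq_mul, Nat.card_Icc, Nat.add_sub_cancel]; ring

end GM2025

end Literature.NumberTheory.Sieve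

end
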